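import Mathlib
import Summits.Schanuel.Schanuel.Theorems.AclSubsetLogFreeCore.Negative.LogFreeCoreObjects
import Summits.Schanuel.Schanuel.Theorems.AclSubsetLogFreeCore.Negative.CoreAutRigidity
import Summits.Schanuel.Schanuel.Theorems.RigidCoreAclSubsetLogFreeCoreResiduePresentations
import Summits.Schanuel.Schanuel.Theorems.RigidCoreAclSubsetLogFreeCoreLogShift
import Literature.NumberTheory.Transcendental.ZilberFieldQuasiminimal
import Literature.NumberTheory.Transcendental.EclClosedSubfield
import Literature.NumberTheory.Transcendental.EclClosedSubfieldSEAC
import Literature.NumberTheory.Transcendental.GammaFieldsEcl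

/-!
# Stub `stub_caseII_transfer` (line `eac-extends-core-automorphisms`, crux stmt-Schanuel-0968):
Case II of the residue, transfer from the countable core `C₀ = ecl ∅` to `ℂ`

Case II of the residue (A₀) of the crux
`Summit.Schanuel.Schanuel.Theses.RigidCore.AclSubsetLogFreeCore` has been abstracted to a statement
`habs` about ZERO-DIMENSIONAL Zilber fields `E` (`ecl ∅ = univ`): an element of the ELA-core of `E`
(the smallest intermediate field containing the kernel generator, closed under `exp`, relatively
algebraically closed and closed under logarithms) which is fixed by every exponential ring
automorphism of `E` lies in the EA-core of `E` (the same without logarithms).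

This file instantiates `habs` at `E := C₀ = ecl ∅ ⊆ ℂ` (`Khovanskii.eclSubfield ∅` with the
restricted exponential `Khovanskii.eclSubfield.instExponentialRing`), granted Zilber's conjecture
`IsZilberField ℂ`:

* `C₀` is a Zilber field (`IsZilberField.eclSubfield_isZilberField`), it is its own `ecl ∅`
  (`CaseIITransfer.ecl_empty_eclSubfield_empty_eq_univ`, from `Khovanskii.eclSubfield.image_ecl`),
  and its kernel is generated by `⟨2πi, _⟩` (`CaseIITransfer.expKernel_core`, from
  `logShift_expKernel_complex`);
* a core-fixed `a ∈ ecl ∅` (fixed by every `g : ℂ → ℂ` with `IsEIsoOn g (ecl ∅) (ecl ∅)`) is fixed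
  by every ring automorphism of `C₀` commuting with `exp` (`forall_isEIsoOn_fixed_iff` of
  `…ResiduePresentations`);
* `a ∈ C_ELA(ℂ)` gives `⟨a, _⟩ ∈ C_ELA(C₀)`: the image in `ℂ` of a member of the ELA-family of `C₀`
  is a member of the ELA-family of `ℂ` (`CaseIITransfer.map_mem_family`: `C₀` is relatively
  algebraically closed, `Khovanskii.mem_ecl_of_isRoot`, and log-closed,
  `GammaField.mem_ecl_of_exp_mem`, in `ℂ`);
* `⟨a, _⟩ ∈ C_EA(C₀)` gives `a ∈ logFreeCore`: the trace on `C₀` of a member of `coreFamily` is a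
  member of the EA-family of `C₀` (`CaseIITransfer.comap_mem_family`).

The image and the trace are taken along the inclusion `C₀ → ℂ`, presented as any `ℚ`-algebra
morphism `ι` which is the coercion pointwise (`hι`; in the proof `ι = C₀.subtype.toRatAlgHom`).
Everything here is elementary and fully proved. [folklore]
-/

noncomputable section

-- `Summit.Schanuel.Schanuel.…` is the single-problem-summit namespace by design (D-0017).
set_option linter.dupNamespace false

open Set
open Literature.ModelTheory.ExponentialFields Literature.ModelTheory.ExponentialFields.ExponentialRing
open Literature.NumberTheory.Transcendental Literature.NumberTheory.Transcendental.GammaField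
open Summit.Schanuel.Schanuel.Theorems.AclSubsetLogFreeCore.Negative

namespace Summit.Schanuel.Schanuel.Theorems.RigidCore

namespace CaseIITransfer

/-! ### The kernel and the closure of `∅` inside an `ecl`-closed E-subfield -/

/-- The kernel of the restricted exponential on an `ecl`-closed E-subfield `ecl X` is generated by
the generator of the kernel of `K` (which lies in `ecl X`). [folklore] -/
theorem expKernel_eclSubfield_eq {K : Type*} [Field K] [ExponentialRing K] {τ : K}
    (hker : expKernel K = AddSubgroup.zmultiples τ) (X : Set K) (hτX : τ ∈ ecl X) :
    expKernel (Khovanskii.eclSubfield X) =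
      AddSubgroup.zmultiples (⟨τ, hτX⟩ : Khovanskii.eclSubfield X) := by
  ext x
  rw [mem_expKernel_iff, AddSubgroup.mem_zmultiples_iff]
  have hK : (ExponentialRing.exp (x : K) = 1) ↔ (x : K) ∈ expKernel K :=
    (mem_expKernel_iff _).symm
  constructor
  · intro hx
    have hx' : ExponentialRing.exp (x : K) = 1 := by
      have := congr_arg Subtype.val hx
      simpa using this
    rw [hK, hker, AddSubgroup.mem_zmultiples_iff] at hx'
    obtain ⟨n, hn⟩ := hx'
    exact ⟨n, Subtype.ext (by simpa using hn)⟩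
  · rintro ⟨n, rfl⟩
    apply Subtype.ext
    have h1 : ExponentialRing.exp
        ((n • (⟨τ, hτX⟩ : Khovanskii.eclSubfield X) : Khovanskii.eclSubfield X) : K) = 1 := by
      rw [hK, hker]
      simp only [AddSubgroupClass.coe_zsmul]
      exact AddSubgroup.zsmul_mem_zmultiples τ n
    simpa using h1

/-- The kernel of the restricted exponential on `C₀ = ecl ∅ ⊆ ℂ` is generated by `⟨2πi, _⟩`.
[folklore] -/
theorem expKernel_core :
    expKernel (Khovanskii.eclSubfield (∅ : Set ℂ)) = AddSubgroup.zmultiples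
      (⟨2 * ↑Real.pi * Complex.I, two_pi_I_mem_ecl_empty⟩ : Khovanskii.eclSubfield (∅ : Set ℂ)) :=
  expKernel_eclSubfield_eq logShift_expKernel_complex (∅ : Set ℂ) two_pi_I_mem_ecl_empty

/-- **`ecl ∅` is its own `ecl ∅`**: the exponential-algebraic closure of `∅` computed in the
E-field `ecl ∅` is everything (`ecl` inside `ecl ∅` is `ecl` in `K`,
`Khovanskii.eclSubfield.image_ecl`). [folklore] -/
theorem ecl_empty_eclSubfield_empty_eq_univ {K : Type*} [Field K] [ExponentialRing K] :
    ecl (∅ : Set (Khovanskii.eclSubfield (∅ : Set K))) = Set.univ := by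
  refine Set.eq_univ_of_forall fun x => ?_
  have h := Khovanskii.eclSubfield.image_ecl (∅ : Set K)
    (∅ : Set (Khovanskii.eclSubfield (∅ : Set K)))
  rw [Set.image_empty] at h
  have hx : (x : K) ∈ ((↑) : Khovanskii.eclSubfield (∅ : Set K) → K) ''
      ecl (∅ : Set (Khovanskii.eclSubfield (∅ : Set K))) := by
    rw [h]
    exact x.2
  obtain ⟨y, hy, hyx⟩ := hx
  have hyx' : y = x := Subtype.ext hyx
  exact hyx' ▸ hy

/-! ### The two families of intermediate fields correspond along the inclusion `C₀ → ℂ` -/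

section Families

variable {ι : Khovanskii.eclSubfield (∅ : Set ℂ) →ₐ[ℚ] ℂ} (hι : ∀ x, ι x = x)
include hι

/-- Membership in the trace `K.comap ι` of an intermediate field `K` of `ℂ`. [folklore] -/
theorem mem_comap_iff {K : IntermediateField ℚ ℂ} {x : Khovanskii.eclSubfield (∅ : Set ℂ)} :
    x ∈ K.comap ι ↔ (x : ℂ) ∈ K := by
  rw [← hι x]
  exact Iff.rfl

/-- Elements of the image of an intermediate field of `C₀` lie in `ecl ∅`. [folklore] -/
theorem mem_ecl_of_mem_map {K' : IntermediateField ℚ (Khovanskii.eclSubfield (∅ : Set ℂ))}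
    {y : ℂ} (hy : y ∈ K'.map ι) : y ∈ ecl (∅ : Set ℂ) := by
  obtain ⟨x, -, rfl⟩ := (IntermediateField.mem_map _).1 hy
  rw [hι]
  exact x.2

/-- **From the ELA-family of `C₀` to the ELA-family of `ℂ`.**  The image in `ℂ` of an
intermediate field `K'` of `C₀` containing `2πi`, closed under `exp`, relatively algebraically
closed in `C₀` and closed under logarithms in `C₀`, has the same four properties in `ℂ`: an element
of `ℂ` algebraic over `K' ⊆ ecl ∅` lies in `ecl ∅` (`Khovanskii.mem_ecl_of_isRoot`), and a logarithm
of an element of `K' ⊆ ecl ∅` lies in `ecl ∅` (`GammaField.mem_ecl_of_exp_mem`). [folklore] -/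
theorem map_mem_family (K' : IntermediateField ℚ (Khovanskii.eclSubfield (∅ : Set ℂ)))
    (hτ : (⟨2 * ↑Real.pi * Complex.I, two_pi_I_mem_ecl_empty⟩ :
      Khovanskii.eclSubfield (∅ : Set ℂ)) ∈ K')
    (hexp : ∀ w ∈ K', exp w ∈ K')
    (halg : ∀ w : Khovanskii.eclSubfield (∅ : Set ℂ), IsAlgebraic K' w → w ∈ K')
    (hlog : ∀ w : Khovanskii.eclSubfield (∅ : Set ℂ), exp w ∈ K' → w ∈ K') :
    (2 * ↑Real.pi * Complex.I : ℂ) ∈ K'.map ι ∧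
    (∀ w ∈ K'.map ι, Complex.exp w ∈ K'.map ι) ∧
    (∀ w : ℂ, IsAlgebraic (K'.map ι) w → w ∈ K'.map ι) ∧
    (∀ w : ℂ, Complex.exp w ∈ K'.map ι → w ∈ K'.map ι) := by
  refine ⟨(IntermediateField.mem_map _).2 ⟨_, hτ, hι _⟩, fun w hw => ?_, fun w hw => ?_,
    fun w hw => ?_⟩
  · obtain ⟨x, hx, rfl⟩ := (IntermediateField.mem_map _).1 hw
    refine (IntermediateField.mem_map _).2 ⟨exp x, hexp x hx, ?_⟩
    rw [hι, hι]
    rfl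
  · -- `w` is algebraic over `K' ⊆ ecl ∅`, hence `w ∈ ecl ∅`
    have hwE : w ∈ ecl (∅ : Set ℂ) := by
      obtain ⟨p, hp0, hpw⟩ := hw
      refine Khovanskii.mem_ecl_of_isRoot (p := p.map (algebraMap (K'.map ι) ℂ))
        ((Polynomial.map_ne_zero_iff (algebraMap (K'.map ι) ℂ).injective).2 hp0)
        (fun n => ?_) ?_
      · rw [Polynomial.coeff_map]
        exact mem_ecl_of_mem_map hι (p.coeff n).2
      · rw [Polynomial.IsRoot, Polynomial.eval_map, ← Polynomial.aeval_def]
        exact hpw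
    -- and `⟨w, _⟩` is algebraic over `K'`
    have hw' : IsAlgebraic (K'.map ι) ((Khovanskii.eclSubfield (∅ : Set ℂ)).subtype
        (⟨w, hwE⟩ : Khovanskii.eclSubfield (∅ : Set ℂ))) := hw
    have halg' : IsAlgebraic K' (⟨w, hwE⟩ : Khovanskii.eclSubfield (∅ : Set ℂ)) :=
      hw'.of_ringHom_of_comp_eq (K'.equivMap ι) (Khovanskii.eclSubfield (∅ : Set ℂ)).subtype
        (K'.equivMap ι).surjective Subtype.val_injective
        (RingHom.ext fun x => (IntermediateField.coe_equivMap_apply K' ι x).trans (hι x))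
    exact (IntermediateField.mem_map _).2 ⟨_, halg _ halg', hι _⟩
  · have hwE : w ∈ ecl (∅ : Set ℂ) := mem_ecl_of_exp_mem (mem_ecl_of_mem_map hι hw)
    obtain ⟨y, hy, hyw⟩ := (IntermediateField.mem_map _).1 hw
    rw [hι] at hyw
    have hy' : y = exp (⟨w, hwE⟩ : Khovanskii.eclSubfield (∅ : Set ℂ)) := Subtype.ext hyw
    exact (IntermediateField.mem_map _).2 ⟨_, hlog ⟨w, hwE⟩ (hy' ▸ hy), hι _⟩

/-- **From the EA-family of `ℂ` to the EA-family of `C₀`.**  The trace on `C₀` of a member of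
`coreFamily` (contains `2πi`, `exp`-closed, relatively algebraically closed in `ℂ`) contains
`⟨2πi, _⟩`, is `exp`-closed and is relatively algebraically closed in `C₀`. [folklore] -/
theorem comap_mem_family {K : IntermediateField ℚ ℂ} (hK : K ∈ coreFamily) :
    (⟨2 * ↑Real.pi * Complex.I, two_pi_I_mem_ecl_empty⟩ :
      Khovanskii.eclSubfield (∅ : Set ℂ)) ∈ K.comap ι ∧
    (∀ w ∈ K.comap ι, exp w ∈ K.comap ι) ∧
    (∀ w : Khovanskii.eclSubfield (∅ : Set ℂ), IsAlgebraic (K.comap ι) w → w ∈ K.comap ι) := by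
  refine ⟨(mem_comap_iff hι).2 hK.1, fun w hw => (mem_comap_iff hι).2 ?_, fun w hw => ?_⟩
  · exact hK.2.1 _ ((mem_comap_iff hι).1 hw)
  -- the inclusion `K ∩ C₀ → K`
  let f : K.comap ι →+* K :=
    { toFun := fun x =>
        ⟨((x : Khovanskii.eclSubfield (∅ : Set ℂ)) : ℂ), (mem_comap_iff hι).1 x.2⟩
      map_one' := rfl
      map_mul' := fun _ _ => rfl
      map_zero' := rfl
      map_add' := fun _ _ => rfl }
  have hf : Function.Injective f := fun x y hxy =>
    Subtype.ext (Subtype.ext (congrArg (fun z : K => (z : ℂ)) hxy))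
  have h : IsAlgebraic K ((Khovanskii.eclSubfield (∅ : Set ℂ)).subtype w) :=
    hw.ringHom_of_comp_eq f (Khovanskii.eclSubfield (∅ : Set ℂ)).subtype hf
      (RingHom.ext fun x => rfl)
  exact (mem_comap_iff hι).2 (hK.2.2 _ h)

end Families

end CaseIITransfer

open CaseIITransfer in
/-- **Stub `stub_caseII_transfer` — Case II, transfer from the countable core to `ℂ`.**  Under
Zilber's conjecture the subfield `C₀ = ecl ∅ ⊆ ℂ` with the induced exponential
(`Khovanskii.eclSubfield.instExponentialRing`) is itself a Zilber field
(`IsZilberField.eclSubfield_isZilberField`) and its own `ecl ∅`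
(`Khovanskii.eclSubfield.image_ecl`); its kernel is generated by `⟨2πi, _⟩`.  Granted the abstract
Case II for every zero-dimensional Zilber field (hypothesis `habs`), the `ℂ`-level statement
follows: a core-fixed `a ∈ ecl ∅` (fixed by every `g` with `IsEIsoOn g (ecl ∅) (ecl ∅)`) is fixed
by every exponential automorphism of `C₀` (`forall_isEIsoOn_fixed_iff`); `a ∈ C_ELA(ℂ)` gives
`⟨a, _⟩ ∈ C_ELA(C₀)` (`map_mem_family`) and `⟨a, _⟩ ∈ C_EA(C₀)` gives `a ∈ logFreeCore`
(`comap_mem_family`, `mem_logFreeCore_iff`). -/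
theorem stub_caseII_transfer (hZ : IsZilberField ℂ) (τ : ℂ) (hτ : τ = 2 * ↑Real.pi * Complex.I)
    (habs : ∀ (E : Type) [Field E] [CharZero E] [ExponentialRing E],
      IsZilberField E → ecl (∅ : Set E) = Set.univ →
      ∀ (τE : E), expKernel E = AddSubgroup.zmultiples τE →
      ∀ a : E,
        a ∈ (sInf {K : IntermediateField ℚ E | τE ∈ K ∧ (∀ w ∈ K, exp w ∈ K) ∧
            (∀ w : E, IsAlgebraic K w → w ∈ K) ∧ (∀ w : E, exp w ∈ K → w ∈ K)} :
              IntermediateField ℚ E) →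
        (∀ θ : E ≃+* E, (∀ x, θ (exp x) = exp (θ x)) → θ a = a) →
          a ∈ (sInf {K : IntermediateField ℚ E | τE ∈ K ∧ (∀ w ∈ K, exp w ∈ K) ∧
            (∀ w : E, IsAlgebraic K w → w ∈ K)} : IntermediateField ℚ E)) :
    ∀ a ∈ ecl (∅ : Set ℂ),
      a ∈ (sInf {K : IntermediateField ℚ ℂ | (2 * ↑Real.pi * Complex.I : ℂ) ∈ K ∧
          (∀ w ∈ K, Complex.exp w ∈ K) ∧ (∀ w : ℂ, IsAlgebraic K w → w ∈ K) ∧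
          (∀ w : ℂ, Complex.exp w ∈ K → w ∈ K)} : IntermediateField ℚ ℂ) →
      (∀ g : ℂ → ℂ, IsEIsoOn g (ecl (∅ : Set ℂ)) (ecl (∅ : Set ℂ)) → g a = a) →
        a ∈ (logFreeCore : Set ℂ) := by
  -- `τ` is bookkeeping for the caller: the conclusion names the kernel generator `2πi` literally.
  have _hτ := hτ
  intro a ha hELA hfix
  -- the inclusion `C₀ → ℂ` as a morphism of `ℚ`-algebras is the coercion
  have hι : ∀ x : Khovanskii.eclSubfield (∅ : Set ℂ),
      (Khovanskii.eclSubfield (∅ : Set ℂ)).subtype.toRatAlgHom x = x := fun _ => rfl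
  -- Case II inside the zero-dimensional Zilber field `C₀ = ecl ∅`
  have hEA : (⟨a, ha⟩ : Khovanskii.eclSubfield (∅ : Set ℂ)) ∈
      (sInf {K : IntermediateField ℚ (Khovanskii.eclSubfield (∅ : Set ℂ)) |
        (⟨2 * ↑Real.pi * Complex.I, two_pi_I_mem_ecl_empty⟩ :
            Khovanskii.eclSubfield (∅ : Set ℂ)) ∈ K ∧
          (∀ w ∈ K, exp w ∈ K) ∧
          (∀ w : Khovanskii.eclSubfield (∅ : Set ℂ), IsAlgebraic K w → w ∈ K)} :
        IntermediateField ℚ (Khovanskii.eclSubfield (∅ : Set ℂ))) := by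
    refine habs (Khovanskii.eclSubfield (∅ : Set ℂ)) (hZ.eclSubfield_isZilberField ∅)
      ecl_empty_eclSubfield_empty_eq_univ _ expKernel_core ⟨a, ha⟩ ?_ fun θ hθ => ?_
    · -- `a ∈ C_ELA(ℂ)` gives `⟨a, _⟩ ∈ C_ELA(C₀)`
      rw [IntermediateField.mem_sInf]
      rintro K' ⟨h1, h2, h3, h4⟩
      have haK : a ∈ K'.map (Khovanskii.eclSubfield (∅ : Set ℂ)).subtype.toRatAlgHom :=
        IntermediateField.mem_sInf.1 hELA _ (map_mem_family hι K' h1 h2 h3 h4)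
      obtain ⟨y, hy, hya⟩ := (IntermediateField.mem_map _).1 haK
      have hy' : y = ⟨a, ha⟩ := Subtype.ext ((hι y).symm.trans hya)
      exact hy' ▸ hy
    · -- core-fixed elements are fixed by the exponential automorphisms of `C₀`
      exact (forall_isEIsoOn_fixed_iff ha).1 hfix ⟨θ, hθ⟩
  -- `⟨a, _⟩ ∈ C_EA(C₀)` gives `a ∈ C_EA(ℂ) = logFreeCore`
  rw [SetLike.mem_coe, mem_logFreeCore_iff]
  intro K hK
  exact (mem_comap_iff hι).1
    (IntermediateField.mem_sInf.1 hEA (K.comap _) (comap_mem_family hι hK))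

end Summit.Schanuel.Schanuel.Theorems.RigidCore
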